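import Summits.QuantumFields.YangMills.Theorems.BalabanUVNodesN28AtBetaOfRecord
import Summits.QuantumFields.BalabanUV.T4Continuum.Spine.NE4.Targets

/-!
# BalabanUVNodes ∕ N17 AT THE STAGE-8 β OF RECORD — DAG node N17 = spine estimate NE4 «scale-shift rate of the FULL β-functions» read at
# `Node00.betaOfMerged βm β⁰ γ` ∕ `Node00.betaOfTerms F ℰ⁰ ℰ¹ ρ bV γ`, BY NAME: what the node IS there, the split road under one-loop rigidity,
# what the node DELIVERS there, and the node on a datum carrying the β of record (companion 4, part 1: §13–§16)

TRACK A (YM-PLAN v0.12.16 §2c row NE4, node N17 of 28; HUMAN RULING D-0062), seat `pub-ymgap-dag-n17-a` gen 3 (-a = KNIT-BY-NAME; ROSTER-D0062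
row n17 «DEPENDENT — knit by name; nothing to hunt»; dag-lead NODE-TABLE v4 row n17).  Companion of `BalabanUVNodesN17Knit.lean` (p408968),
`…N17KnitEdge.lean` (p409440 ∕ p409892 ∕ p410452) and `…N17KnitTransfer.lean` (p411569), written for the ONE new input since those files: the
β-FUNCTIONS OF RECORD of NODE 00 stage ₈ (`Literature/…/Node00/BetaOfRecord.lean`, p410806): design (β) `betaOfMerged βm β⁰ γ` = `β⁰_{k+1} +
𝟙_{]0,γ]^{k+1}}·(β_merged − β⁰)` (ON the record box the merged β of (1.22), OFF it the one-loop number; the definer's assembly line is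
`betaOfMerged (betaMerged F 𝓝rec ρ bV) (beta0OfMerged … v₀) θ.γ`), design (α) `betaOfTerms F ℰ⁰ ℰ¹ ρ bV γ` (two term families; IS the (β)-shape,
`N28AtBetaOfRecord.betaOfTerms_eq_betaOfMerged`).  Part 2 (`…N17AtBetaOfRecordKernels.lean`): the in-edges in kernel currency on the record's own
polarisation kernels, the box cap (kernel negative), non-vacuity.  THEOREMS ONLY: def-free, sorry-free, standard axioms; every decl cites an
existing tree theorem BY NAME or is elementary real analysis.  HONEST FRAMING: count-neutral kernel bookkeeping at the record's β-field; NE4 is NOT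
IN PRINT ([Balaban1987RG1] p. 264 «We will investigate other properties in a separate paper»), NOT PROVED here, DEPENDENT on rows NE2∕NE3 (N15∕N16)
and the one-loop rate (AF-0r); `βm`, `β⁰`, `γ` and every rate below are PARAMETERS ∕ BINDERS — nothing of Bałaban's β is asserted; one finite T⁴ at
fixed ε — nothing continuum ∕ ℝ⁴ ∕ OS ∕ mass-gap ∕ Clay.

WHAT IS PROVED (all `[folklore]`-grade real analysis over the cited definitions).
* §13 BOX READING.  `ScaleShiftRate c θ γ' β` (NE4 typed, `T4CouplingMatching` :180) reads `β` ONLY on the boxes `]0,γ']^{k+1}`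
  (`scaleShiftRate_congr_boxes`); hence AT THE RECORD, for every box side `γ' ≤ γ` (the record's `θ.γ`), **N17 IS N17 of the merged β**:
  `scaleShiftRate_betaOfMerged_iff` (and node U2's history moduli likewise, `histLipschitz_betaOfMerged_iff`); design (α): N17 of `β⁰ + β¹` unboxed
  (`scaleShiftRate_betaOfTerms_iff`).
* §14 THE SPLIT ROAD AT THE RECORD («β⁰ conv + β¹ shift», file 1 §2) UNDER ONE-LOOP RIGIDITY (`N28AtBetaOfRecord.oneLoopSplit_unique`): for EVERY
  printed split `S` of the β of record, the (AF-0r) binder `|S.β0 k − β⁰_∞| ≤ c₀θ^k` IS the statement about the record's NAMED one-loop number `β⁰`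
  (`af0r_atRecord_iff`) and the β¹-binder `RemainderShiftRate S c₁ θ γ'` IS NE4's own predicate for the merged remainder `β_merged − β⁰`
  (`remainderShiftRate_atRecord_iff`); so N17 at the record ⇐ (AF-0r)(β⁰) ∧ `ScaleShiftRate c₁ θ γ' (β_merged − β⁰)`
  (`scaleShiftRate_betaOfMerged_of_rates`, constant `2c₀ + c₁`; through any split literally by `T4CouplingMatching.scaleShiftRate_of_split`:
  `scaleShiftRate_betaOfMerged_of_split_atRecord`), and conversely the remainder's rate ⇐ N17 of the merged β ∧ (AF-0r)
  (`remainderRate_of_scaleShiftRate_merged`).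
* §15 WHAT N17 DELIVERS AT THE RECORD (design (β)): if the definer's one-sided limit defining `β⁰_k := lim_{g_k→0⁺} β_merged,k` EXISTS
  (`Node00.Beta0LimitExists`, NAMED by the definer, chair R434 (c3)) at a COHERENT ADMISSIBLE reference history `v₀` (`Fin.tail (v₀ (k+1)) = v₀ k`,
  entries in `]0,γ']` — e.g. constant histories), then N17 of the merged β ALONE gives the CAUCHY form `|β⁰_{k+2} − β⁰_{k+1}| ≤ cθ^k` of the record's
  one-loop numbers (`abs_beta0OfMerged_step_le` — pass to the limit `g → 0⁺` in the shift inequality; NO corner ∕ Lipschitz bound (AF-1) needed, contrast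
  `Spine.NE4.AsymptoticContent.abs_beta0_step_le_of_scaleShiftRate`), hence (AF-0r) `∃ β⁰_∞, |β⁰_{k+1} − β⁰_∞| ≤ (c∕(1−θ))θ^k` for THE object
  `Node00.beta0OfMerged βm v₀` (`af0r_beta0OfMerged_of_scaleShiftRate`, `af0r_beta0OfMerged_constHist`) and the remainder's rate — packaged
  `atRecord_content_of_scaleShiftRate_merged`: at the record the node's two halves are ONE statement (`ScaleShiftRate c θ γ' β_merged`), and its
  β⁰-half is an OUTPUT feeding every `hconv` consumer of NODE O ∕ K3 (`FlowStepRuns` §10, `Beta.Assembly.LimitForm.conv`).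
* §16 ON THE DATUM: for any finite-ε datum `D` whose β-family IS the β of record (`D.βfun = betaOfMerged βm β⁰ γ`, the Stage-8 datum D₀ by construction),
  `NE4OnData D c θ γ' ↔ ScaleShiftRate c θ γ' βm` (`N17_atRecord_iff_merged`; node U2's whole input triple likewise, `u2Inputs_atRecord_iff`), N17 at D₀
  from the two rates (`N17_atRecord_of_rates`), and N17 at D₀
  DELIVERS (AF-0r) of `beta0OfMerged` (`af0r_of_N17_atRecord`).  The N17 → N27 edge at D₀ is file 3's `u2Output_under_of_N17_gap` verbatim (every
  hypothesis there is a box predicate; `BetaUpperH` at the record ↔ merged by `N28AtBetaOfRecord.betaUpperH_betaOfMerged_iff`), not restated.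
Sources (locators only): T. Bałaban, CMP **109** (1987) 249–301 [Balaban1987RG1]: (0.20) p. 256, (1.20)–(1.22) p. 264, (2.12)–(2.14) p. 268, p. 298.
Nothing here is a claim about the Yang–Mills mass gap.
-/

namespace Summit.QuantumFields.YangMills.Theorems.BalabanUVNodesN17

open Filter Topology
open Literature.MathematicalPhysics.QuantumFieldTheory.Balaban1983to89
open Literature.MathematicalPhysics.QuantumFieldTheory.Balaban1983to89.FlowStep
open Literature.MathematicalPhysics.QuantumFieldTheory.Balaban1983to89.T4CouplingMatching
open Literature.MathematicalPhysics.QuantumFieldTheory.Balaban1983to89.T4Continuum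
open Literature.MathematicalPhysics.QuantumFieldTheory.Balaban1983to89.T4FlagMemory (tail_mem_box)
open Literature.MathematicalPhysics.QuantumFieldTheory.Balaban1983to89.Node00 (betaOfMerged beta0OfMerged betaOfTerms beta0OfTerms
  beta1OfTerms TermFamily0 TermFamily1 Beta0LimitExists tendsto_beta0OfMerged)
open Summit.QuantumFields.YangMills.BalabanUVNodes.N28AtBetaOfRecord (betaOfMerged_eqOn oneLoopSplit_β0_eq oneLoopSplit_β1_eq
  betaOfTerms_eq_betaOfMerged)
open Summit.QuantumFields.BalabanUV.T4Continuum.Spine.NE4 (NE4OnData U2Inputs ne4OnData_iff)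

universe u

/-! ## §13 BOX READING — `ScaleShiftRate` reads β on the boxes only; at the record N17 IS N17 of the merged β (`γ' ≤ γ`) -/

section BoxReading

variable {βm : HBeta} {β0 : ℕ → ℝ} {γ γ' c θ : ℝ}

/-- **NE4 reads β on the boxes only.**  Two history families that agree on every box `]0,γ']^{k+1}` have the same `ScaleShiftRate c θ γ'`
(the tail of a box history is a box history, `T4FlagMemory.tail_mem_box`). [folklore] -/
theorem scaleShiftRate_congr_boxes {β β' : HBeta} {c θ γ' : ℝ}
    (h : ∀ k (v : Fin (k + 1) → ℝ), v ∈ Box γ' k → β k v = β' k v) :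
    ScaleShiftRate c θ γ' β ↔ ScaleShiftRate c θ γ' β' := by
  refine forall₃_congr fun k w hw => ?_
  rw [h (k + 1) w hw, h k (Fin.tail w) (tail_mem_box hw)]

/-- **N17 AT THE RECORD IS N17 OF THE MERGED β** on every box side `γ' ≤ γ` inside the record box: the off-box convention of
`Node00.betaOfMerged` is invisible to NE4 there (`N28AtBetaOfRecord.betaOfMerged_eqOn`). [cite: Balaban1987RG1, (1.22) p.264] -/
theorem scaleShiftRate_betaOfMerged_iff (hγ : γ' ≤ γ) :
    ScaleShiftRate c θ γ' (betaOfMerged βm β0 γ) ↔ ScaleShiftRate c θ γ' βm :=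
  scaleShiftRate_congr_boxes fun k _ hv => betaOfMerged_eqOn hγ k hv

/-- Node U2's history moduli `HistLipschitz Λ γ'` (`T4CouplingMatching` §1; [Balaban1987RG1] p. 298 «depends also on all preceding coupling constants»,
no modulus printed) also read β on the boxes only. [cite: Balaban1987RG1, §5 p.298] -/
theorem histLipschitz_congr_boxes {β β' : HBeta} {Λ : ℕ → ℕ → ℝ} {γ' : ℝ}
    (h : ∀ k (v : Fin (k + 1) → ℝ), v ∈ Box γ' k → β k v = β' k v) :
    HistLipschitz Λ γ' β ↔ HistLipschitz Λ γ' β' := by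
  refine forall₅_congr fun k p q hp hq => ?_
  rw [h k p hp, h k q hq]

/-- … so AT THE RECORD the history moduli of node U2's triple are those of the merged β (`γ' ≤ γ`). [cite: Balaban1987RG1, §5 p.298] -/
theorem histLipschitz_betaOfMerged_iff {Λ : ℕ → ℕ → ℝ} (hγ : γ' ≤ γ) :
    HistLipschitz Λ γ' (betaOfMerged βm β0 γ) ↔ HistLipschitz Λ γ' βm :=
  histLipschitz_congr_boxes fun k _ hv => betaOfMerged_eqOn hγ k hv

end BoxReading

section BoxReadingAlpha

variable {𝔄 : Type*} [NormedRing 𝔄] [NormedAlgebra ℝ 𝔄]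
variable {V : Type*} [NormedAddCommGroup V] [NormedSpace ℝ V] {ι : Type*} [Fintype ι]

/-- **Design (α)**: N17 at the two-term-family β of record `betaOfTerms F ℰ⁰ ℰ¹ ρ bV γ` IS N17 of the unboxed family `β⁰_{k+1} + β¹_{k+1}(v)`
on every box side `γ' ≤ γ` (`N28AtBetaOfRecord.betaOfTerms_eq_betaOfMerged` + §13). [cite: Balaban1987RG1, (1.22) p.264] -/
theorem scaleShiftRate_betaOfTerms_iff (F : T4Family) (ℰ0 : TermFamily0 F 𝔄) (ℰ1 : TermFamily1 F 𝔄) (ρ : V →L[ℝ] 𝔄)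
    (bV : Module.Basis ι ℝ V) {γ γ' c θ : ℝ} (hγ : γ' ≤ γ) :
    ScaleShiftRate c θ γ' (betaOfTerms F ℰ0 ℰ1 ρ bV γ) ↔
      ScaleShiftRate c θ γ' (fun k w => beta0OfTerms F ℰ0 ρ bV k + beta1OfTerms F ℰ1 ρ bV k w) := by
  rw [betaOfTerms_eq_betaOfMerged]
  exact scaleShiftRate_betaOfMerged_iff hγ

end BoxReadingAlpha

/-! ## §14 THE SPLIT ROAD AT THE RECORD under one-loop rigidity: the two binders of file 1 §2 are about the NAMED objects β⁰ and β_merged − β⁰ -/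

section SplitRoad

variable {βm : HBeta} {β0 : ℕ → ℝ} {γ γ' : ℝ}

/-- **(AF-0r) AT THE RECORD is about THE one-loop number of record.**  For EVERY printed split `S` of the β of record ([Balaban1987RG1]
(2.12)–(2.14); unique, `N28AtBetaOfRecord.oneLoopSplit_β0_eq`) the binder `|S.β0 k − β⁰_∞| ≤ c₀θ^k` of file 1's `N17_of_split` IS the same inequality
for the record's named `β⁰` (in the definer's assembly: the `limUnder (𝓝[>] 0)` object `Node00.beta0OfMerged`). [cite: Balaban1987RG1, (2.12)-(2.14) p.268] -/
theorem af0r_atRecord_iff (S : B12Beta.OneLoopSplit (betaOfMerged βm β0 γ)) {binf c₀ θ : ℝ} :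
    (∀ k, |S.β0 k - binf| ≤ c₀ * θ ^ k) ↔ ∀ k, |β0 k - binf| ≤ c₀ * θ ^ k := by
  simp only [oneLoopSplit_β0_eq S]

/-- **The β¹-half of NE4 AT THE RECORD is NE4's own predicate for the merged remainder.**  For EVERY printed split `S` of the β of record and every
box side `γ' ≤ γ`: `RemainderShiftRate S c₁ θ γ' ↔ ScaleShiftRate c₁ θ γ' (β_merged − β⁰)` (`N28AtBetaOfRecord.oneLoopSplit_β1_eq`: the remainder of
every split is the boxed `𝟙·(β_merged − β⁰)`, read on boxes inside the record box). [cite: Balaban1987RG1, (2.12)-(2.14) p.268] -/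
theorem remainderShiftRate_atRecord_iff (S : B12Beta.OneLoopSplit (betaOfMerged βm β0 γ)) {c₁ θ : ℝ} (hγ : γ' ≤ γ) :
    RemainderShiftRate S c₁ θ γ' ↔ ScaleShiftRate c₁ θ γ' (fun k w => βm k w - β0 k) := by
  unfold RemainderShiftRate ScaleShiftRate
  refine forall₃_congr fun k w hw => ?_
  rw [oneLoopSplit_β1_eq S, oneLoopSplit_β1_eq S, Set.indicator_of_mem (box_mono hγ _ hw),
    Set.indicator_of_mem (box_mono hγ _ (tail_mem_box hw))]

/-- **(AF-0r)(β⁰) ∧ rate of the merged remainder ⟹ N17 of the MERGED β** (triangle inequality through `β⁰_∞`, `θ^{k+1} ≤ θ^k`; `0 ≤ θ ≤ 1`,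
`0 ≤ c₀`; no box-side restriction). [folklore] -/
theorem scaleShiftRate_merged_of_rates {binf c₀ c₁ θ : ℝ} (hθ0 : 0 ≤ θ) (hθ1 : θ ≤ 1) (hc₀ : 0 ≤ c₀)
    (hconv : ∀ k, |β0 k - binf| ≤ c₀ * θ ^ k) (hrem : ScaleShiftRate c₁ θ γ' fun k w => βm k w - β0 k) :
    ScaleShiftRate (2 * c₀ + c₁) θ γ' βm := by
  intro k w hw
  have h1 := hconv (k + 1)
  have h2 := hconv k
  have h3 : |(βm (k + 1) w - β0 (k + 1)) - (βm k (Fin.tail w) - β0 k)| ≤ c₁ * θ ^ k := hrem k w hw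
  have hθk : θ ^ (k + 1) ≤ θ ^ k := pow_le_pow_of_le_one hθ0 hθ1 (Nat.le_succ k)
  have e : βm (k + 1) w - βm k (Fin.tail w)
      = (β0 (k + 1) - binf) - (β0 k - binf) + ((βm (k + 1) w - β0 (k + 1)) - (βm k (Fin.tail w) - β0 k)) := by ring
  rw [e]
  calc |(β0 (k + 1) - binf) - (β0 k - binf) + ((βm (k + 1) w - β0 (k + 1)) - (βm k (Fin.tail w) - β0 k))|
      ≤ |β0 (k + 1) - binf| + |β0 k - binf| + |(βm (k + 1) w - β0 (k + 1)) - (βm k (Fin.tail w) - β0 k)| :=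
        (abs_add_le _ _).trans (add_le_add (abs_sub _ _) le_rfl)
    _ ≤ c₀ * θ ^ (k + 1) + c₀ * θ ^ k + c₁ * θ ^ k := add_le_add (add_le_add h1 h2) h3
    _ ≤ (2 * c₀ + c₁) * θ ^ k := by nlinarith [mul_le_mul_of_nonneg_left hθk hc₀]

/-- **N17 AT THE RECORD ⇐ (AF-0r)(β⁰) ∧ `ScaleShiftRate c₁ θ γ' (β_merged − β⁰)`** — file 1's road «β⁰ conv + β¹ shift» with both binders now
statements about the record's NAMED objects, box side `γ' ≤ γ`; constant `2c₀ + c₁`. [cite: Balaban1987RG1, (2.12)-(2.14) p.268] -/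
theorem scaleShiftRate_betaOfMerged_of_rates {binf c₀ c₁ θ : ℝ} (hγ : γ' ≤ γ) (hθ0 : 0 ≤ θ) (hθ1 : θ ≤ 1) (hc₀ : 0 ≤ c₀)
    (hconv : ∀ k, |β0 k - binf| ≤ c₀ * θ ^ k) (hrem : ScaleShiftRate c₁ θ γ' fun k w => βm k w - β0 k) :
    ScaleShiftRate (2 * c₀ + c₁) θ γ' (betaOfMerged βm β0 γ) :=
  (scaleShiftRate_betaOfMerged_iff hγ).mpr (scaleShiftRate_merged_of_rates hθ0 hθ1 hc₀ hconv hrem)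

/-- … the same through ANY printed split `S` of the β of record, literally by `T4CouplingMatching.scaleShiftRate_of_split` (file 1's `N17_of_split`
at the record), the binders translated by `af0r_atRecord_iff` ∕ `remainderShiftRate_atRecord_iff`. [cite: Balaban1987RG1, (2.12)-(2.14) p.268] -/
theorem scaleShiftRate_betaOfMerged_of_split_atRecord (S : B12Beta.OneLoopSplit (betaOfMerged βm β0 γ)) {binf c₀ c₁ θ : ℝ}
    (hγ : γ' ≤ γ) (hθ0 : 0 ≤ θ) (hθ1 : θ ≤ 1) (hc₀ : 0 ≤ c₀)
    (hconv : ∀ k, |β0 k - binf| ≤ c₀ * θ ^ k) (hrem : ScaleShiftRate c₁ θ γ' fun k w => βm k w - β0 k) :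
    ScaleShiftRate (2 * c₀ + c₁) θ γ' (betaOfMerged βm β0 γ) :=
  scaleShiftRate_of_split S hθ0 hθ1 hc₀ ((af0r_atRecord_iff S).mpr hconv)
    ((remainderShiftRate_atRecord_iff S hγ).mpr hrem)

/-- **Conversely: N17 of the merged β ∧ (AF-0r)(β⁰) ⟹ the merged remainder's rate** with constant `c + 2c₀` (triangle inequality; the record-level
form of `T4BetaMemorySharp.remainderShiftRate_of_scaleShiftRate`). [folklore] -/
theorem remainderRate_of_scaleShiftRate_merged {binf c₀ c θ : ℝ} (hθ0 : 0 ≤ θ) (hθ1 : θ ≤ 1) (hc₀ : 0 ≤ c₀)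
    (hconv : ∀ k, |β0 k - binf| ≤ c₀ * θ ^ k) (h : ScaleShiftRate c θ γ' βm) :
    ScaleShiftRate (c + 2 * c₀) θ γ' fun k w => βm k w - β0 k := by
  intro k w hw
  have h1 := hconv (k + 1)
  have h2 := hconv k
  have h3 := h k w hw
  have hθk : θ ^ (k + 1) ≤ θ ^ k := pow_le_pow_of_le_one hθ0 hθ1 (Nat.le_succ k)
  show |(βm (k + 1) w - β0 (k + 1)) - (βm k (Fin.tail w) - β0 k)| ≤ (c + 2 * c₀) * θ ^ k
  have e : (βm (k + 1) w - β0 (k + 1)) - (βm k (Fin.tail w) - β0 k)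
      = (βm (k + 1) w - βm k (Fin.tail w)) - ((β0 (k + 1) - binf) - (β0 k - binf)) := by ring
  rw [e]
  calc |(βm (k + 1) w - βm k (Fin.tail w)) - ((β0 (k + 1) - binf) - (β0 k - binf))|
      ≤ |βm (k + 1) w - βm k (Fin.tail w)| + (|β0 (k + 1) - binf| + |β0 k - binf|) :=
        (abs_sub _ _).trans (add_le_add le_rfl (abs_sub _ _))
    _ ≤ c * θ ^ k + (c₀ * θ ^ (k + 1) + c₀ * θ ^ k) := add_le_add h3 (add_le_add h1 h2)
    _ ≤ (c + 2 * c₀) * θ ^ k := by nlinarith [mul_le_mul_of_nonneg_left hθk hc₀]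

end SplitRoad

/-! ## §15 WHAT N17 DELIVERS AT THE RECORD (design (β)): (AF-0r) for the record's one-loop number `Node00.beta0OfMerged βm v₀` from N17 of the
merged β alone, by passing to the definer's one-sided limit — no corner bound -/

section Delivers

variable {βm : HBeta} {v₀ : (k : ℕ) → (Fin (k + 1) → ℝ)} {γ γ' c θ : ℝ}

/-- **N17 of the merged β ⟹ the Cauchy form of (AF-0r) for the record's one-loop numbers.**  If the one-sided limit
`β⁰_k = lim_{g→0⁺} β_merged,k(v₀ with last entry g)` EXISTS (`Node00.Beta0LimitExists`, named by the definer) at a reference history that is COHERENT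
(`Fin.tail (v₀ (k+1)) = v₀ k`) and ADMISSIBLE (entries in `]0,γ']`, `γ' > 0`), then `ScaleShiftRate c θ γ' β_merged` gives
`|β⁰_{k+2} − β⁰_{k+1}| ≤ cθ^k`: the shift inequality at the histories `(v₀ with last entry g)`, whose tails are again of that form, passes to the
limit `g → 0⁺` (`le_of_tendsto`). [cite: Balaban1987RG1, (2.12)-(2.14) p.268] -/
theorem abs_beta0OfMerged_step_le (hlim : Beta0LimitExists βm v₀) (hcoh : ∀ k, Fin.tail (v₀ (k + 1)) = v₀ k)
    (hadm : ∀ k i, 0 < v₀ k i ∧ v₀ k i ≤ γ') (hγ' : 0 < γ') (h : ScaleShiftRate c θ γ' βm) (k : ℕ) :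
    |beta0OfMerged βm v₀ (k + 1) - beta0OfMerged βm v₀ k| ≤ c * θ ^ k := by
  have t1 := tendsto_beta0OfMerged βm v₀ hlim (k + 1)
  have t0 := tendsto_beta0OfMerged βm v₀ hlim k
  have hev : ∀ᶠ g in 𝓝[>] (0 : ℝ),
      |βm (k + 1) (Function.update (v₀ (k + 1)) (Fin.last (k + 1)) g)
        - βm k (Function.update (v₀ k) (Fin.last k) g)| ≤ c * θ ^ k := by
    filter_upwards [Ioc_mem_nhdsGT hγ'] with g hg
    have hw : Function.update (v₀ (k + 1)) (Fin.last (k + 1)) g ∈ Box γ' (k + 1) := mem_box.mpr fun i => by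
      by_cases hi : i = Fin.last (k + 1)
      · subst hi
        rw [Function.update_self]
        exact ⟨hg.1, hg.2⟩
      · rw [Function.update_of_ne hi]
        exact hadm (k + 1) i
    have htail : Fin.tail (Function.update (v₀ (k + 1)) (Fin.last (k + 1)) g)
        = Function.update (v₀ k) (Fin.last k) g := by
      rw [← Fin.succ_last, Fin.tail_update_succ, hcoh]
    have hk := h k _ hw
    rwa [htail] at hk
  exact le_of_tendsto (t1.sub t0).abs hev

/-- **N17 of the merged β ⟹ (AF-0r) for the record's one-loop number** `Node00.beta0OfMerged βm v₀`: with `θ < 1` the Cauchy form sums to a limit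
`β⁰_∞` with `|β⁰_{k+1} − β⁰_∞| ≤ (c∕(1−θ))·θ^k` (`cauchySeq_of_le_geometric`, `dist_le_of_le_geometric_of_tendsto`) — LITERALLY the `hconv` input of
`FlowStepRuns` §10 ∕ the field `conv` of `Beta.Assembly.LimitForm` for the split of record. [cite: Balaban1987RG1, (2.12)-(2.14) p.268] -/
theorem af0r_beta0OfMerged_of_scaleShiftRate (hlim : Beta0LimitExists βm v₀) (hcoh : ∀ k, Fin.tail (v₀ (k + 1)) = v₀ k)
    (hadm : ∀ k i, 0 < v₀ k i ∧ v₀ k i ≤ γ') (hγ' : 0 < γ') (hθ1 : θ < 1) (h : ScaleShiftRate c θ γ' βm) :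
    ∃ binf : ℝ, ∀ k, |beta0OfMerged βm v₀ k - binf| ≤ c / (1 - θ) * θ ^ k := by
  have hstep : ∀ n, dist (beta0OfMerged βm v₀ n) (beta0OfMerged βm v₀ (n + 1)) ≤ c * θ ^ n := fun n => by
    rw [Real.dist_eq, abs_sub_comm]
    exact abs_beta0OfMerged_step_le hlim hcoh hadm hγ' h n
  obtain ⟨binf, hb⟩ := cauchySeq_tendsto_of_complete (cauchySeq_of_le_geometric θ c hθ1 hstep)
  refine ⟨binf, fun k => ?_⟩
  have hk := dist_le_of_le_geometric_of_tendsto θ c hθ1 hstep hb k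
  rw [Real.dist_eq] at hk
  calc |beta0OfMerged βm v₀ k - binf| ≤ c * θ ^ k / (1 - θ) := hk
    _ = c / (1 - θ) * θ ^ k := by ring

/-- Constant reference histories `v₀ k ≡ g₀` (`0 < g₀ ≤ γ'`) are coherent and admissible: N17 of the merged β ⟹ (AF-0r) for
`beta0OfMerged βm (fun _ _ ↦ g₀)`. [folklore] -/
theorem af0r_beta0OfMerged_constHist {g₀ : ℝ} (hg₀ : 0 < g₀) (hg₀γ : g₀ ≤ γ')
    (hlim : Beta0LimitExists βm fun _ _ => g₀) (hθ1 : θ < 1) (h : ScaleShiftRate c θ γ' βm) :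
    ∃ binf : ℝ, ∀ k, |beta0OfMerged βm (fun _ _ => g₀) k - binf| ≤ c / (1 - θ) * θ ^ k :=
  af0r_beta0OfMerged_of_scaleShiftRate hlim (fun _ => rfl) (fun _ _ => ⟨hg₀, hg₀γ⟩) (hg₀.trans_le hg₀γ) hθ1 h

/-- **THE CONTENT OF N17 AT THE RECORD, PACKAGED (design (β)).**  On a box side `0 < γ' ≤ γ`, with `0 ≤ θ < 1` and the definer's one-sided limit
existing at a coherent admissible reference history, `ScaleShiftRate c θ γ' β_merged` ALONE yields: N17 at the β of record built with THE one-loop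
number `β⁰ := beta0OfMerged βm v₀` ∧ (AF-0r) for that `β⁰` (constant `c∕(1−θ)`) ∧ the merged remainder's rate (constant `c + 2c∕(1−θ)`).  At the
datum of record the node's two halves are ONE statement, and its β⁰-half is an OUTPUT. [cite: Balaban1987RG1, (2.12)-(2.14) p.268] -/
theorem atRecord_content_of_scaleShiftRate_merged (hγ : γ' ≤ γ) (hγ' : 0 < γ') (hθ0 : 0 ≤ θ) (hθ1 : θ < 1)
    (hlim : Beta0LimitExists βm v₀) (hcoh : ∀ k, Fin.tail (v₀ (k + 1)) = v₀ k)
    (hadm : ∀ k i, 0 < v₀ k i ∧ v₀ k i ≤ γ') (h : ScaleShiftRate c θ γ' βm) :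
    ScaleShiftRate c θ γ' (betaOfMerged βm (beta0OfMerged βm v₀) γ) ∧
      (∃ binf : ℝ, ∀ k, |beta0OfMerged βm v₀ k - binf| ≤ c / (1 - θ) * θ ^ k) ∧
      ScaleShiftRate (c + 2 * (c / (1 - θ))) θ γ' (fun k w => βm k w - beta0OfMerged βm v₀ k) := by
  obtain ⟨binf, hconv⟩ := af0r_beta0OfMerged_of_scaleShiftRate hlim hcoh hadm hγ' hθ1 h
  have hc : 0 ≤ c := by
    have hw : (fun _ : Fin (0 + 2) => γ') ∈ Box γ' (0 + 1) := mem_box.mpr fun _ => ⟨hγ', le_rfl⟩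
    have := (abs_nonneg _).trans (h 0 _ hw)
    simpa using this
  exact ⟨(scaleShiftRate_betaOfMerged_iff hγ).mpr h, ⟨binf, hconv⟩,
    remainderRate_of_scaleShiftRate_merged hθ0 hθ1.le (div_nonneg hc (by linarith)) hconv h⟩

end Delivers

/-! ## §16 ON THE DATUM OF RECORD — `NE4OnData D c θ γ'` for a datum whose β-family IS the β of record -/

section OnDatum

variable {F : T4Family} {G : Type u} [GaugeGroup G] [MeasurableSpace G] [HaarData G]
variable {βm : HBeta} {β0 : ℕ → ℝ} {γ γ' : ℝ}

/-- **N17 AT D₀ IS N17 OF THE MERGED β.**  For a finite-ε datum whose β-family is the β of record (`D.βfun = betaOfMerged βm β⁰ γ` — the Stage-8 datum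
by construction) and a box side `γ' ≤ γ`: `NE4OnData D c θ γ' ↔ ScaleShiftRate c θ γ' β_merged` (`Spine.NE4.ne4OnData_iff` + §13).
[cite: Balaban1987RG1, (1.22) p.264] -/
theorem N17_atRecord_iff_merged (D : FiniteEpsData F G) {c θ : ℝ} (hD : D.βfun = betaOfMerged βm β0 γ) (hγ : γ' ≤ γ) :
    NE4OnData D c θ γ' ↔ ScaleShiftRate c θ γ' βm := by
  rw [ne4OnData_iff, hD]
  exact scaleShiftRate_betaOfMerged_iff hγ

/-- **NODE U2's INPUT TRIPLE AT D₀ reads the merged β** (file 1's `u2Inputs_of_u3edge` ∕ file 3's `u2Inputs_of_transferModel` deliver this triple; at the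
record it is `ScaleShiftRate ∧ HistLipschitz` OF β_merged plus the β-free fading-memory clause), box side `γ' ≤ γ`. [cite: Balaban1987RG1, §5 p.298] -/
theorem u2Inputs_atRecord_iff (D : FiniteEpsData F G) {c C θ : ℝ} {Λ : ℕ → ℕ → ℝ} (hD : D.βfun = betaOfMerged βm β0 γ)
    (hγ : γ' ≤ γ) :
    U2Inputs D c C θ γ' Λ ↔ ScaleShiftRate c θ γ' βm ∧ HistLipschitz Λ γ' βm ∧ FadingMemory C θ Λ := by
  unfold U2Inputs
  rw [hD, scaleShiftRate_betaOfMerged_iff hγ, histLipschitz_betaOfMerged_iff hγ]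

/-- **N17 AT D₀ ⇐ (AF-0r)(β⁰) ∧ the merged remainder's rate** (§14; constant `2c₀ + c₁`, box side `γ' ≤ γ`).  Both binders UNPRINTED: (AF-0r) = GAPS
G-an2-4 (rows NE2 ∕ an1–an2), the remainder's rate = rows NE3 ∕ NE5 read through (1.22). [cite: Balaban1987RG1, (2.12)-(2.14) p.268] -/
theorem N17_atRecord_of_rates (D : FiniteEpsData F G) {binf c₀ c₁ θ : ℝ} (hD : D.βfun = betaOfMerged βm β0 γ)
    (hγ : γ' ≤ γ) (hθ0 : 0 ≤ θ) (hθ1 : θ ≤ 1) (hc₀ : 0 ≤ c₀)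
    (hconv : ∀ k, |β0 k - binf| ≤ c₀ * θ ^ k) (hrem : ScaleShiftRate c₁ θ γ' fun k w => βm k w - β0 k) :
    NE4OnData D (2 * c₀ + c₁) θ γ' := by
  rw [ne4OnData_iff, hD]
  exact scaleShiftRate_betaOfMerged_of_rates hγ hθ0 hθ1 hc₀ hconv hrem

/-- **N17 AT D₀ DELIVERS (AF-0r) OF THE RECORD's ONE-LOOP NUMBER** (§15): for a datum built with `β⁰ := beta0OfMerged βm v₀` (the definer's assembly
line), `NE4OnData D c θ γ'` on a box side `0 < γ' ≤ γ` with `θ < 1`, the one-sided limit existing at a coherent admissible `v₀` ⟹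
`∃ β⁰_∞, |β⁰_{k+1} − β⁰_∞| ≤ (c∕(1−θ))θ^k` — the `hconv` input of NODE O's ∕ K3's consumers, supplied BY the node at the record.
[cite: Balaban1987RG1, (2.12)-(2.14) p.268] -/
theorem af0r_of_N17_atRecord (D : FiniteEpsData F G) {v₀ : (k : ℕ) → (Fin (k + 1) → ℝ)} {c θ : ℝ}
    (hD : D.βfun = betaOfMerged βm (beta0OfMerged βm v₀) γ) (hγ : γ' ≤ γ) (hγ' : 0 < γ') (hθ1 : θ < 1)
    (hlim : Beta0LimitExists βm v₀) (hcoh : ∀ k, Fin.tail (v₀ (k + 1)) = v₀ k)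
    (hadm : ∀ k i, 0 < v₀ k i ∧ v₀ k i ≤ γ') (h : NE4OnData D c θ γ') :
    ∃ binf : ℝ, ∀ k, |beta0OfMerged βm v₀ k - binf| ≤ c / (1 - θ) * θ ^ k :=
  af0r_beta0OfMerged_of_scaleShiftRate hlim hcoh hadm hγ' hθ1 ((N17_atRecord_iff_merged D hD hγ).mp h)

end OnDatum

end Summit.QuantumFields.YangMills.Theorems.BalabanUVNodesN17
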